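import Literature.Probability.LatticeModels.PolymerPressure
import HarnessLib

/-!
# Crux `AnchorGap` (stmt-QuantumFields-11141), line `registered` — the ATOM-RESOLVED one-polymer
# recursion of a hard-core subset gas (step (G4) of the assembly of GREP `stub_gaussianBBFPolymerRep`)

Generic polymer-gas combinatorics (def-free over the tree's `PolymerGas` / `ClusterExpansion` /
`PolymerPressure`): the tree's clique deletion
`Literature.Probability.LatticeModels.polymerPartitionFunction_eq_sdiff_add_sum`
(`Ξ(Λ) = Ξ(Λ ∖ D) + Σ_{γ ∈ D} z γ · Ξ({γ' ∈ Λ ∖ D : γ' compatible with γ})` for a clique `D` of pairwise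
incompatible polymers), specialised to the subset gas of an atom set `X` with the meet-or-equal
incompatibility `polyInc` and polymers of size `≥ 2` and the clique of the polymers THROUGH A GIVEN
ATOM `b`, is the recursion over THE POLYMER CONTAINING `b`:
`Ξ(𝒫 X) = Ξ(𝒫 (X ∖ {b})) + Σ_{Y ∈ 𝒫 X, b ∈ Y} K Y · Ξ(𝒫 (X ∖ Y))`, `𝒫 X := {Y ⊆ X : 2 ≤ |Y|}`
(`polymerPartitionFunction_atom_recursion`) — the shape in which the Battle–Brydges–Federbush
expansion of a normalised Gaussian expectation, peeled from the least atom, reproduces the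
hard-core gas (LOCATE-GREP (G4), evidence on stmt-QuantumFields-11141).  [folklore]; no definition,
no named fact.
-/

set_option autoImplicit false

namespace Summit.QuantumFields.YangMills.Theorems.AnchorGap.AtomGas

open Finset Literature.Probability.LatticeModels



section Atoms

variable {β : Type} [DecidableEq β]

/-- The polymers through `b` are pairwise `polyInc`-incompatible. [folklore] -/
theorem polyInc_of_mem_of_mem {b : β} {Y Y' : Finset β} (hY : b ∈ Y) (hY' : b ∈ Y') : polyInc Y Y' :=
  Or.inr ⟨b, mem_inter.2 ⟨hY, hY'⟩⟩

/-- The polymers of `X` avoiding `b` are the polymers of `X ∖ {b}`. [folklore] -/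
theorem polys_sdiff_through (X : Finset β) (b : β) :
    (X.powerset.filter fun Y : Finset β => 2 ≤ Y.card) \
        ((X.powerset.filter fun Y : Finset β => 2 ≤ Y.card).filter fun Y => b ∈ Y)
      = (X.erase b).powerset.filter fun Y : Finset β => 2 ≤ Y.card := by
  ext Y
  simp only [mem_sdiff, mem_filter, mem_powerset, subset_erase, not_and]
  tauto

/-- The polymers of `X ∖ {b}` compatible with a polymer `Y ∋ b` are the polymers of `X ∖ Y`.
[folklore] -/
theorem polys_filter_compatible (X : Finset β) {b : β} {Y : Finset β} (hbY : b ∈ Y) :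
    (((X.erase b).powerset.filter fun Y' : Finset β => 2 ≤ Y'.card).filter fun Y' => ¬ polyInc Y Y')
      = (X \ Y).powerset.filter fun Y' : Finset β => 2 ≤ Y'.card := by
  ext Y'
  simp only [mem_filter, mem_powerset, polyInc, not_or, not_nonempty_iff_eq_empty, subset_sdiff,
    disjoint_iff_inter_eq_empty, subset_erase]
  constructor
  · rintro ⟨⟨⟨hX, -⟩, h2⟩, -, hint⟩
    exact ⟨⟨hX, by rwa [inter_comm]⟩, h2⟩
  · rintro ⟨⟨hX, hint⟩, h2⟩
    rw [inter_comm] at hint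
    have hbY' : b ∉ Y' := fun h => by
      have : b ∈ Y ∩ Y' := mem_inter.2 ⟨hbY, h⟩
      rw [hint] at this; exact notMem_empty b this
    refine ⟨⟨⟨hX, hbY'⟩, h2⟩, ?_, hint⟩
    rintro rfl
    exact hbY' hbY

/-- **The atom-resolved one-polymer recursion** of the hard-core subset gas with polymers of size
`≥ 2`: for every activity `K : Finset β → ℂ`, atom set `X` and atom `b ∈ X`,
`Ξ(𝒫 X) = Ξ(𝒫 (X ∖ {b})) + Σ_{Y ∈ 𝒫 X, b ∈ Y} K Y · Ξ(𝒫 (X ∖ Y))`,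
`𝒫 X = {Y ⊆ X : 2 ≤ |Y|}` (resolve the unique polymer containing `b`, if any; the tree's clique
deletion `polymerPartitionFunction_eq_sdiff_add_sum` for the clique of polymers through `b`). [folklore] -/
theorem polymerPartitionFunction_atom_recursion (K : Finset β → ℂ) (X : Finset β) (b : β) :
    polymerPartitionFunction polyInc K (X.powerset.filter fun Y : Finset β => 2 ≤ Y.card)
      = polymerPartitionFunction polyInc K ((X.erase b).powerset.filter fun Y : Finset β => 2 ≤ Y.card)
        + ∑ Y ∈ (X.powerset.filter fun Y : Finset β => 2 ≤ Y.card).filter (fun Y => b ∈ Y),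
            K Y * polymerPartitionFunction polyInc K ((X \ Y).powerset.filter fun Y' : Finset β => 2 ≤ Y'.card) := by
  have h := polymerPartitionFunction_eq_sdiff_add_sum (inc := polyInc) K
    (Λ := X.powerset.filter fun Y : Finset β => 2 ≤ Y.card)
    (D := (X.powerset.filter fun Y : Finset β => 2 ≤ Y.card).filter fun Y => b ∈ Y)
    (filter_subset _ _)
    (fun Y hY Y' hY' _ => polyInc_of_mem_of_mem (mem_filter.1 hY).2 (mem_filter.1 hY').2)
  rw [h, polys_sdiff_through]
  congr 1
  refine sum_congr rfl fun Y hY => ?_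
  rw [polys_filter_compatible X (mem_filter.1 hY).2]

end Atoms

end Summit.QuantumFields.YangMills.Theorems.AnchorGap.AtomGas
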